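import Summits.CriticalPhenomena.PercolationContinuityZ3.Theorems.SahiMasterFamilyFCombOneSharedDict

/-!
# SCHEME Σ: class (S4b) of `φ` with its displacement rule (support file)

Support file (prover seat `prim-bnk-2`, gen 31–32; `--supports stmt-CriticalPhenomena-4575`).  Proof document
`run/shared/lean/prim/prim-l12/prim-bnk-2/PROOF-THEOREM-I1.md` §2 (✓adm) and §3 (injectivity).

(S4b): a `T1⁻` unit `((x, y), 0)` with `e ∈ z` and `x_I ∈ A = a*` goes to the preferred `T1⁺` unit
`π = (G_T(x_I) ∪ x_J + e, y)` unless a leaver (class S9b) takes `π`, in which case it goes to the `T2⁺` unit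
`α = (τ(x_I) ∪ x_J + e, y)`.  The collision forces `σ_{J∖w} x_J ∈ A_w` (`sdiff_mem_A_of_mem_leaverTargets`), hence
`z_J ∉ C⁰` (admissibility of `α`) and `x_J ∈ T_w` (signature `6` of `α`; the preferred unit has signature `5`).  Then
admissibility (`phi_adm_S4b`) and injectivity on each of the two sub-classes (`inj_S4bπ`, `inj_S4bα`).  No definitions; no `sorry`.
-/

namespace Summit.CriticalPhenomena.PercolationContinuityZ3.Theorems

namespace SahiFComb.Shift

open Finset FinsetFamily
open scoped Classical

variable {ι : Type*} [Fintype ι] [DecidableEq ι] [LinearOrder ι]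

namespace OneShared

variable {S : OneShared ι}

/-! ### The collision condition -/

/-- The collision condition of the displacement rule: if a unit `((x \ I) ∪ g ∪ {e}, y)` (`g ⊆ I`) is a leaver target, then
`(J \ w) \ x_J ∈ A_w` (`w = y ∩ J`). [this work] -/
theorem sdiff_mem_A_of_mem_leaverTargets {x y g : Finset ι} (hgI : g ⊆ S.I)
    (hLT : (((x \ S.I) ∪ g ∪ {S.e}, y), 0) ∈ S.leaverTargets) :
    (S.J \ (y ∩ S.J)) \ (x ∩ S.J) ∈ (S.dataJ (y ∩ S.J)).A := by
  unfold OneShared.leaverTargets at hLT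
  obtain ⟨q, hq, hqπ⟩ := mem_image.1 hLT
  have hLq : ((q.1, q.2), 2) ∈ S.leaverSet := (mem_filter.1 hq).2
  rw [show (q, 2) = ((q.1, q.2), 2) from rfl, leaverMap_eq hLq] at hqπ
  set f₀ : ↥S.rout.𝓟 := ⟨_, leaver_memP hLq⟩ with hf₀
  have hslot := (S.rout.ρ f₀).2
  rw [mem_routP_iff] at hslot
  obtain ⟨hw₀J, ht₀J, -, hslotA⟩ := hslot
  have hg₀I : ((S.dataI q.2).Φl ⟨q.1 ∩ S.I, leaver_memI hLq⟩ : Finset ι) ⊆ S.I := by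
    have hm := ((S.dataI q.2).Φl ⟨q.1 ∩ S.I, leaver_memI hLq⟩).2
    have hQR : ∀ s ∈ secHigh (S.I \ (q.2 ∩ S.I)) S.e S.B, s ⊆ S.I \ (q.2 ∩ S.I) := fun s hs => (mem_secHigh.1 hs).1
    have hAR : ∀ s ∈ (S.dataI q.2).A, s ⊆ S.I \ (q.2 ∩ S.I) := fun s hs =>
      ((mem_image_ground_sdiff _ hQR).1 (mem_sdiff.1 ((S.dataI q.2).hAa hs)).1).1
    exact ((mem_image_ground_sdiff _ hAR).1 hm).1.trans sdiff_subset
  simp only [Prod.mk.injEq, and_true] at hqπ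
  obtain ⟨hx', hy'⟩ := hqπ
  -- compare `J`-traces: `t₀ = x ∩ J`, `w₀ = y ∩ J`
  have ht₀ : ((S.rout.ρ f₀ : ↥S.rout.𝓟) : Finset ι × Finset ι).2 = x ∩ S.J := by
    have h1 : ((((S.dataI q.2).Φl ⟨q.1 ∩ S.I, leaver_memI hLq⟩ : Finset ι) ∪
        ((S.rout.ρ f₀ : ↥S.rout.𝓟) : Finset ι × Finset ι).2 ∪ {S.e}) ∩ S.J) = ((x \ S.I) ∪ g ∪ {S.e}) ∩ S.J := by
      rw [hx']
    rw [nfe_inter_other S.hIJ S.heJ hgI, union_inter_distrib_right, union_inter_distrib_right,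
      singleton_inter_of_notMem S.heJ, union_empty, inter_eq_left.2 ht₀J] at h1
    rw [← h1]
    ext i; simp only [mem_union, mem_inter]
    constructor
    · intro h; exact Or.inr h
    · rintro (⟨h, hi⟩ | h)
      · exact absurd hi (fun hJ => disjoint_left.1 S.hIJ (hg₀I h) hJ)
      · exact h
  have hw₀ : ((S.rout.ρ f₀ : ↥S.rout.𝓟) : Finset ι × Finset ι).1 = y ∩ S.J := by
    have h1 : ((q.2 ∩ S.I) ∪ ((S.rout.ρ f₀ : ↥S.rout.𝓟) : Finset ι × Finset ι).1) ∩ S.J = y ∩ S.J := by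
      rw [hy']
    rw [union_inter_distrib_right, inter_eq_left.2 hw₀J] at h1
    rw [← h1]
    ext i; simp only [mem_union, mem_inter]
    constructor
    · intro h; exact Or.inr h
    · rintro (⟨⟨-, hi⟩, hJ⟩ | h)
      · exact absurd hi (fun hI => disjoint_left.1 S.hIJ hI hJ)
      · exact h
  rw [ht₀, hw₀] at hslotA
  rw [show (S.J \ (y ∩ S.J)) \ (x ∩ S.J) = S.J \ (y ∩ S.J ∪ x ∩ S.J) from sdiff_sdiff_left]
  exact hslotA

/-- Under the collision condition, `z_J = (J \ w) \ x_J ∉ C⁰|_{J \ w}`. [this work] -/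
theorem sdiff_notMem_secLow_of_mem_leaverTargets {x y g : Finset ι} (hgI : g ⊆ S.I)
    (hLT : (((x \ S.I) ∪ g ∪ {S.e}, y), 0) ∈ S.leaverTargets) :
    (S.J \ (y ∩ S.J)) \ (x ∩ S.J) ∉ secLow (S.J \ (y ∩ S.J)) S.C :=
  (mem_sdiff.1 ((S.dataJ (y ∩ S.J)).hAa (sdiff_mem_A_of_mem_leaverTargets hgI hLT))).2

/-- Under the collision condition, `x_J ∈ T_w = σ A_w` (when `x_J ⊆ J \ w`). [this work] -/
theorem inter_mem_T_of_mem_leaverTargets {x y g : Finset ι} (hgI : g ⊆ S.I) (hxJ : x ∩ S.J ⊆ S.J \ (y ∩ S.J))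
    (hLT : (((x \ S.I) ∪ g ∪ {S.e}, y), 0) ∈ S.leaverTargets) :
    x ∩ S.J ∈ (S.dataJ (y ∩ S.J)).A.image (fun t => (S.J \ (y ∩ S.J)) \ t) := by
  have hQR : ∀ s ∈ secHigh (S.J \ (y ∩ S.J)) S.e S.C, s ⊆ S.J \ (y ∩ S.J) := fun s hs => (mem_secHigh.1 hs).1
  have hAR : ∀ s ∈ (S.dataJ (y ∩ S.J)).A, s ⊆ S.J \ (y ∩ S.J) := fun s hs =>
    ((mem_image_ground_sdiff _ hQR).1 (mem_sdiff.1 ((S.dataJ (y ∩ S.J)).hAa hs)).1).1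
  exact (mem_image_ground_sdiff _ hAR).2 ⟨hxJ, sdiff_mem_A_of_mem_leaverTargets hgI hLT⟩

/-! ### Class (S4b): `T1⁻`, `e ∈ z`, `x_I ∈ A` -/

/-- (S4b) the value of `φ`: the preferred unit `π`, or the displaced unit `α` if `π` is a leaver target. [this work] -/
theorem phi_eq_S4b {x y : Finset ι} (hex : S.e ∉ x) (hey : S.e ∉ y) (hA : x ∩ S.I ∈ (S.dataI y).A) :
    S.phi ((x, y), 0) =
      if (((x \ S.I) ∪ ((S.dataI y).GT ⟨x ∩ S.I, hA⟩ : Finset ι) ∪ {S.e}, y), 0) ∈ S.leaverTargets then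
        (((x \ S.I) ∪ ((S.dataI y).τ ⟨x ∩ S.I, hA⟩ : Finset ι) ∪ {S.e}, y), 1)
      else (((x \ S.I) ∪ ((S.dataI y).GT ⟨x ∩ S.I, hA⟩ : Finset ι) ∪ {S.e}, y), 0) := by
  unfold OneShared.phi
  simp only [hey, hex, if_false, if_true]
  rw [dif_pos hA]

/-- (S4b, preferred) the value of `φ` when `π` is not a leaver target. [this work] -/
theorem phi_eq_S4bπ {x y : Finset ι} (hex : S.e ∉ x) (hey : S.e ∉ y) (hA : x ∩ S.I ∈ (S.dataI y).A)
    (hLT : (((x \ S.I) ∪ ((S.dataI y).GT ⟨x ∩ S.I, hA⟩ : Finset ι) ∪ {S.e}, y), 0) ∉ S.leaverTargets) :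
    S.phi ((x, y), 0) = (((x \ S.I) ∪ ((S.dataI y).GT ⟨x ∩ S.I, hA⟩ : Finset ι) ∪ {S.e}, y), 0) := by
  rw [phi_eq_S4b hex hey hA, if_neg hLT]

/-- (S4b, displaced) the value of `φ` when `π` is a leaver target. [this work] -/
theorem phi_eq_S4bα {x y : Finset ι} (hex : S.e ∉ x) (hey : S.e ∉ y) (hA : x ∩ S.I ∈ (S.dataI y).A)
    (hLT : (((x \ S.I) ∪ ((S.dataI y).GT ⟨x ∩ S.I, hA⟩ : Finset ι) ∪ {S.e}, y), 0) ∈ S.leaverTargets) :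
    S.phi ((x, y), 0) = (((x \ S.I) ∪ ((S.dataI y).τ ⟨x ∩ S.I, hA⟩ : Finset ι) ∪ {S.e}, y), 1) := by
  rw [phi_eq_S4b hex hey hA, if_pos hLT]

/-- (S4b) the trace `G_T(x_I)` lies in `T = σA`: `⊆ R`, `∈ σA`, `∈ Q`, `σ(·) ∉ P`. [this work] -/
theorem img_S4b_GT {x y : Finset ι} (hA : x ∩ S.I ∈ (S.dataI y).A) :
    ((S.dataI y).GT ⟨x ∩ S.I, hA⟩ : Finset ι) ⊆ S.I \ (y ∩ S.I) ∧
      ((S.dataI y).GT ⟨x ∩ S.I, hA⟩ : Finset ι) ∈ (S.dataI y).A.image (fun t => (S.I \ (y ∩ S.I)) \ t) ∧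
      ((S.dataI y).GT ⟨x ∩ S.I, hA⟩ : Finset ι) ∈ secHigh (S.I \ (y ∩ S.I)) S.e S.B ∧
      (S.I \ (y ∩ S.I)) \ ((S.dataI y).GT ⟨x ∩ S.I, hA⟩ : Finset ι) ∉ secLow (S.I \ (y ∩ S.I)) S.B := by
  set d := S.dataI y with hd
  have hQR : ∀ s ∈ secHigh (S.I \ (y ∩ S.I)) S.e S.B, s ⊆ S.I \ (y ∩ S.I) := fun s hs => (mem_secHigh.1 hs).1
  have hσQR : ∀ s ∈ (secHigh (S.I \ (y ∩ S.I)) S.e S.B).image (fun t => (S.I \ (y ∩ S.I)) \ t), s ⊆ S.I \ (y ∩ S.I) :=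
    fun s hs => ((mem_image_ground_sdiff _ hQR).1 hs).1
  have hAR : ∀ s ∈ d.A, s ⊆ S.I \ (y ∩ S.I) := fun s hs => hσQR s (mem_sdiff.1 (d.hAa hs)).1
  have hgmem : (d.GT ⟨x ∩ S.I, hA⟩ : Finset ι) ∈ d.A.image (fun t => (S.I \ (y ∩ S.I)) \ t) := (d.GT ⟨x ∩ S.I, hA⟩).2
  have hg := hgmem
  rw [mem_image_ground_sdiff _ hAR] at hg
  obtain ⟨hgR, hgA⟩ := hg
  have hσg := d.hAa hgA
  rw [mem_sdiff, mem_image_ground_sdiff _ hQR, sdiff_sdiff_right_self, inf_eq_inter, inter_eq_right.2 hgR] at hσg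
  obtain ⟨⟨-, hgQ⟩, hσgP⟩ := hσg
  exact ⟨hgR, hgmem, hgQ, hσgP⟩

/-- (S4b) the trace `τ(x_I)` lies in `Δ = Q \ P`. [this work] -/
theorem img_S4b_τ {x y : Finset ι} (hA : x ∩ S.I ∈ (S.dataI y).A) :
    ((S.dataI y).τ ⟨x ∩ S.I, hA⟩ : Finset ι) ⊆ S.I \ (y ∩ S.I) ∧
      ((S.dataI y).τ ⟨x ∩ S.I, hA⟩ : Finset ι) ∈ secHigh (S.I \ (y ∩ S.I)) S.e S.B ∧
      ((S.dataI y).τ ⟨x ∩ S.I, hA⟩ : Finset ι) ∉ secLow (S.I \ (y ∩ S.I)) S.B := by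
  have hgmem := ((S.dataI y).τ ⟨x ∩ S.I, hA⟩).2
  rw [mem_sdiff] at hgmem
  exact ⟨(mem_secHigh.1 hgmem.1).1, hgmem.1, hgmem.2⟩

/-- **Class (S4b)**: a `T1⁻` unit with `e ∈ z` and `x_I ∈ A` goes to `π = (G_T(x_I) ∪ x_J + e, y)` (`T1⁺`) or, if a leaver
takes `π`, to `α = (τ(x_I) ∪ x_J + e, y)` (`T2⁺`). [this work] -/
theorem phi_adm_S4b {x y : Finset ι} (hu : ((x, y), 0) ∈ ThreePartition.negUnitSetF S.B S.C) (hex : S.e ∉ x) (hey : S.e ∉ y)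
    (hA : x ∩ S.I ∈ (S.dataI y).A) :
    S.phi ((x, y), 0) ∈ ThreePartition.posUnitSetF S.B S.C ∧ x ⊆ (S.phi ((x, y), 0)).1.1 ∧ y ⊆ (S.phi ((x, y), 0)).1.2 := by
  rw [mem_negUnitSetF_iff] at hu
  obtain ⟨hxy, h⟩ := hu
  simp only at hxy h
  rcases h with ⟨-, ⟨hxC, -⟩, -⟩ | ⟨h1, -⟩ | ⟨h2, -⟩
  rotate_left
  · exact absurd h1 (by norm_num)
  · exact absurd h2 (by norm_num)
  set R := S.I \ (y ∩ S.I) with hR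
  set d := S.dataI y with hd
  -- `x_J ∈ C¹|_{J \ w}` (from `x ∈ C`, `e ∉ x`, and `C⁰ ⊆ C¹`)
  have hxJ : x ∩ S.J ∈ secHigh (S.J \ (y ∩ S.J)) S.e S.C :=
    secLow_subset_secHigh S.hCup (subset_univ _) (mem_univ _)
      ((mem_C_iff_secLow hex (inter_subset_sdiff_inter hxy S.J)).1 hxC)
  by_cases hLT : (((x \ S.I) ∪ (d.GT ⟨x ∩ S.I, hA⟩ : Finset ι) ∪ {S.e}, y), 0) ∈ S.leaverTargets
  · -- displaced: `α`, a `T2⁺` unit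
    rw [phi_eq_S4bα hex hey hA hLT]
    obtain ⟨hgR, hgQ, -⟩ := img_S4b_τ hA
    have hgdom : x ∩ S.I ⊆ (d.τ ⟨x ∩ S.I, hA⟩ : Finset ι) := d.hτ ⟨x ∩ S.I, hA⟩
    set g := (d.τ ⟨x ∩ S.I, hA⟩ : Finset ι) with hg
    have hgI : g ⊆ S.I := hgR.trans sdiff_subset
    have hGTI : (d.GT ⟨x ∩ S.I, hA⟩ : Finset ι) ⊆ S.I := (img_S4b_GT hA).1.trans sdiff_subset
    have hzJ := sdiff_notMem_secLow_of_mem_leaverTargets hGTI hLT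
    have hdisj' : Disjoint ((x \ S.I) ∪ g ∪ {S.e}) y := nfe_disjoint hxy hgR hey
    rw [mem_posUnitSetF_iff]
    refine ⟨⟨hdisj', Or.inr (Or.inl ⟨rfl, ⟨?_, ?_⟩, ?_⟩)⟩, nfe_subset hgdom, subset_rfl⟩
    · refine (mem_B_iff_secHigh (R := R) nfe_mem ?_).2 ?_
      · rw [nfe_inter S.heI hgI]; exact hgR
      · rw [nfe_inter S.heI hgI]; exact hgQ
    · refine (mem_C_iff_secHigh nfe_mem (inter_subset_sdiff_inter hdisj' S.J)).2 ?_
      rw [nfe_inter_other S.hIJ S.heJ hgI]; exact hxJ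
    · intro hz'C
      have hz'J : (((x \ S.I) ∪ g ∪ {S.e}) ∪ y)ᶜ ∩ S.J = (S.J \ (y ∩ S.J)) \ (x ∩ S.J) := by
        rw [compl_union_inter_eq, nfe_inter_other S.hIJ S.heJ hgI]
      have h1 := (mem_C_iff_secLow nfe_notMem_compl (hz'J ▸ sdiff_subset)).1 hz'C
      rw [hz'J] at h1
      exact hzJ h1
  · -- preferred: `π`, a `T1⁺` unit
    rw [phi_eq_S4bπ hex hey hA hLT]
    obtain ⟨hgR, -, hgQ, hσgP⟩ := img_S4b_GT hA
    have hgdom : x ∩ S.I ⊆ (d.GT ⟨x ∩ S.I, hA⟩ : Finset ι) := d.hGT ⟨x ∩ S.I, hA⟩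
    set g := (d.GT ⟨x ∩ S.I, hA⟩ : Finset ι) with hg
    have hgI : g ⊆ S.I := hgR.trans sdiff_subset
    have hdisj' : Disjoint ((x \ S.I) ∪ g ∪ {S.e}) y := nfe_disjoint hxy hgR hey
    rw [mem_posUnitSetF_iff]
    refine ⟨⟨hdisj', Or.inl ⟨rfl, ⟨?_, ?_⟩, ?_⟩⟩, nfe_subset hgdom, subset_rfl⟩
    · refine (mem_B_iff_secHigh (R := R) nfe_mem ?_).2 ?_
      · rw [nfe_inter S.heI hgI]; exact hgR
      · rw [nfe_inter S.heI hgI]; exact hgQ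
    · refine (mem_C_iff_secHigh nfe_mem (inter_subset_sdiff_inter hdisj' S.J)).2 ?_
      rw [nfe_inter_other S.hIJ S.heJ hgI]; exact hxJ
    · intro hz'B
      have hz'I : (((x \ S.I) ∪ g ∪ {S.e}) ∪ y)ᶜ ∩ S.I = R \ g := nfe_compl_inter S.heI hgI
      have h1 := (mem_B_iff_secLow nfe_notMem_compl (hz'I ▸ sdiff_subset)).1 hz'B
      rw [hz'I] at h1
      exact hσgP h1

/-- (S4b, preferred) signature of the target: `5`. [this work] -/
theorem sig_phi_S4bπ {x y : Finset ι} (hex : S.e ∉ x) (hey : S.e ∉ y) (hA : x ∩ S.I ∈ (S.dataI y).A)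
    (hLT : (((x \ S.I) ∪ ((S.dataI y).GT ⟨x ∩ S.I, hA⟩ : Finset ι) ∪ {S.e}, y), 0) ∉ S.leaverTargets) :
    S.sig (S.phi ((x, y), 0)) = 5 := by
  obtain ⟨hgR, hgT, -, -⟩ := img_S4b_GT hA
  have hgI := hgR.trans sdiff_subset
  rw [phi_eq_S4bπ hex hey hA hLT]
  refine S.sig_eq_5 rfl hey nfe_mem ?_ hLT
  show ((x \ S.I) ∪ _ ∪ {S.e}) ∩ S.I ∈ _
  rw [nfe_inter S.heI hgI]; exact hgT

/-- (S4b, displaced) signature of the target: `6`. [this work] -/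
theorem sig_phi_S4bα {x y : Finset ι} (hu : ((x, y), 0) ∈ ThreePartition.negUnitSetF S.B S.C) (hex : S.e ∉ x)
    (hey : S.e ∉ y) (hA : x ∩ S.I ∈ (S.dataI y).A)
    (hLT : (((x \ S.I) ∪ ((S.dataI y).GT ⟨x ∩ S.I, hA⟩ : Finset ι) ∪ {S.e}, y), 0) ∈ S.leaverTargets) :
    S.sig (S.phi ((x, y), 0)) = 6 := by
  have hxy : Disjoint x y := ((mem_negUnitSetF_iff _ _ _).1 hu).1
  obtain ⟨hgR, -, hgP⟩ := img_S4b_τ hA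
  have hgI := hgR.trans sdiff_subset
  have hGTI : ((S.dataI y).GT ⟨x ∩ S.I, hA⟩ : Finset ι) ⊆ S.I := (img_S4b_GT hA).1.trans sdiff_subset
  have hT := inter_mem_T_of_mem_leaverTargets hGTI (inter_subset_sdiff_inter hxy S.J) hLT
  rw [phi_eq_S4bα hex hey hA hLT]
  refine S.sig_eq_6 rfl hey nfe_mem ?_ ?_
  · show ((x \ S.I) ∪ _ ∪ {S.e}) ∩ S.J ∈ _
    rw [nfe_inter_other S.hIJ S.heJ hgI]; exact hT
  · show ((x \ S.I) ∪ _ ∪ {S.e}) ∩ S.I ∉ _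
    rw [nfe_inter S.heI hgI]; exact hgP

/-- (S4b, preferred) `φ` is injective on the sub-class. [this work] -/
theorem inj_S4bπ {x₁ y₁ x₂ y₂ : Finset ι} (hex₁ : S.e ∉ x₁) (hey₁ : S.e ∉ y₁) (hA₁ : x₁ ∩ S.I ∈ (S.dataI y₁).A)
    (hLT₁ : (((x₁ \ S.I) ∪ ((S.dataI y₁).GT ⟨x₁ ∩ S.I, hA₁⟩ : Finset ι) ∪ {S.e}, y₁), 0) ∉ S.leaverTargets)
    (hex₂ : S.e ∉ x₂) (hey₂ : S.e ∉ y₂) (hA₂ : x₂ ∩ S.I ∈ (S.dataI y₂).A)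
    (hLT₂ : (((x₂ \ S.I) ∪ ((S.dataI y₂).GT ⟨x₂ ∩ S.I, hA₂⟩ : Finset ι) ∪ {S.e}, y₂), 0) ∉ S.leaverTargets)
    (h : S.phi ((x₁, y₁), 0) = S.phi ((x₂, y₂), 0)) : ((x₁, y₁), 0) = ((x₂, y₂), 0) := by
  rw [phi_eq_S4bπ hex₁ hey₁ hA₁ hLT₁, phi_eq_S4bπ hex₂ hey₂ hA₂ hLT₂] at h
  simp only [Prod.mk.injEq, and_true] at h
  obtain ⟨hx, rfl⟩ := h
  have hg₁I := (img_S4b_GT hA₁).1.trans sdiff_subset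
  have hg₂I := (img_S4b_GT hA₂).1.trans sdiff_subset
  have hI : x₁ ∩ S.I = x₂ ∩ S.I :=
    congrArg Subtype.val ((S.dataI _).GT.injective (Subtype.ext (nfe_eq_nfe_inter S.heI hg₁I hg₂I hx)))
  have hJ : x₁ ∩ S.J = x₂ ∩ S.J := nfe_eq_nfe_inter_other S.hIJ S.heJ hg₁I hg₂I hx
  rw [part_eq_of_traces (s := x₁) (s' := x₂) ⟨fun h => absurd h hex₁, fun h => absurd h hex₂⟩ hI hJ]

/-- (S4b, displaced) `φ` is injective on the sub-class. [this work] -/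
theorem inj_S4bα {x₁ y₁ x₂ y₂ : Finset ι} (hex₁ : S.e ∉ x₁) (hey₁ : S.e ∉ y₁) (hA₁ : x₁ ∩ S.I ∈ (S.dataI y₁).A)
    (hLT₁ : (((x₁ \ S.I) ∪ ((S.dataI y₁).GT ⟨x₁ ∩ S.I, hA₁⟩ : Finset ι) ∪ {S.e}, y₁), 0) ∈ S.leaverTargets)
    (hex₂ : S.e ∉ x₂) (hey₂ : S.e ∉ y₂) (hA₂ : x₂ ∩ S.I ∈ (S.dataI y₂).A)
    (hLT₂ : (((x₂ \ S.I) ∪ ((S.dataI y₂).GT ⟨x₂ ∩ S.I, hA₂⟩ : Finset ι) ∪ {S.e}, y₂), 0) ∈ S.leaverTargets)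
    (h : S.phi ((x₁, y₁), 0) = S.phi ((x₂, y₂), 0)) : ((x₁, y₁), 0) = ((x₂, y₂), 0) := by
  rw [phi_eq_S4bα hex₁ hey₁ hA₁ hLT₁, phi_eq_S4bα hex₂ hey₂ hA₂ hLT₂] at h
  simp only [Prod.mk.injEq, and_true] at h
  obtain ⟨hx, rfl⟩ := h
  have hg₁I := (img_S4b_τ hA₁).1.trans sdiff_subset
  have hg₂I := (img_S4b_τ hA₂).1.trans sdiff_subset
  have hI : x₁ ∩ S.I = x₂ ∩ S.I :=
    congrArg Subtype.val ((S.dataI _).τ.injective (Subtype.ext (nfe_eq_nfe_inter S.heI hg₁I hg₂I hx)))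
  have hJ : x₁ ∩ S.J = x₂ ∩ S.J := nfe_eq_nfe_inter_other S.hIJ S.heJ hg₁I hg₂I hx
  rw [part_eq_of_traces (s := x₁) (s' := x₂) ⟨fun h => absurd h hex₁, fun h => absurd h hex₂⟩ hI hJ]

end OneShared

end SahiFComb.Shift

end Summit.CriticalPhenomena.PercolationContinuityZ3.Theorems
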